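import Summits.BirchSwinnertonDyer.Rank1Residual.P2.CongruentNumberLevelTwoDoor
import HarnessLib

/-!
# The `#Sel₄(E_n) = 2⁶` hypothesis of C⁺ (item 23431) is LOAD-BEARING: granted `BSD(E_n, 2)`, on the `#Sel₂ = 2⁵` rank-one class
# `2 ∥ 𝓛(n) ⟺ #Sel₄(E_n) = 2⁶` and `4 ∣ 𝓛(n) ⟺ #Sel₄(E_n) ≠ 2⁶` — the B-side companion of the level-two door
# (crux stmt-BirchSwinnertonDyer-20509 `RamifiedOffTYZOfFacts`, line `offtyz-v7`, LEAD cruxlead-20509 g19, cycle 20; fact-free, `def`-free, no `sorry`)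

HONEST FRAMING (cell `bsd-print-cf2`, route `PrintCf2`; `--supports stmt-BirchSwinnertonDyer-20509`).  BSD is not proved by any of this; no class is
closed by this file; item 23431 (C⁺) and crux 20509 stay OPEN.

WHY THIS FILE.  The LEAD lineage g0–g18 landed ≈150 files toward C⁺ = `RamifiedJumpOneLevelTwoOfFacts` («`n` square-free, `n ≡ 5,6,7 (8)`,
`r_an(E_n) = 1`, `#Sel₂(E_n) = 2⁵`, `#Sel₄(E_n) = 2⁶` ⟹ `2 ∥ 𝓛(n)`»); NONE of them uses the hypothesis `#Sel₄(E_n) = 2⁶` (it is only passed to the door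
`P2.bsdp_two_congruentNumberCurve_iff_two_dvd_not_four_dvd`).  The census of the line (g17/g18, kit j339721) exhibits members of the `#Sel₂ = 2⁵`
rank-one class with `#Sel₄ ≠ 2⁶` and `4 ∣ 𝓛(n)` (the «B-members» 9143, …, 39263, 41447, …).  This file makes the structural point a kernel theorem,
conditional exactly on `BSD(E_n, 2)` (the statement the route is about) and GZK:

* §1 `four_dvd_of_bsdp_two_of_natCard_selmerGroup_four_ne` — granted GZK: `n` square-free, `r_an(E_n) = 1`, `#Sel₂(E_n) = 2⁵`, `#Sel₄(E_n) ≠ 2⁶`,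
  `BSD(E_n, 2)`, `𝓛(n)² = L²` ⟹ **`4 ∣ L`** (B-SIDE DOOR: `#Ш[2] = 4`, `Ш[2] ≤ Ш[2^∞]` of `2`-power order `≠ 4`, and `2·ord₂ L = ord₂ #Ш[2^∞]` is even
  ⟹ `ord₂ #Ш[2^∞] ≥ 4`).
* §1 ★ `padicValInt_two_eq_one_iff_natCard_selmerGroup_four_eq` — granted GZK and `BSD(E_n, 2)`, on the `#Sel₂ = 2⁵` rank-one class:
  **`ord₂ L = 1 ⟺ #Sel₄(E_n) = 2⁶`** (and `2 ∣ L` always: `not_odd_of_bsdp_two_of_natCard_selmerGroup_two`).  So the conclusion of C⁺ DETECTS the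
  Cassels–Tate jump condition: no argument blind to `#Sel₄` can prove C⁺ on a class that contains a B-member satisfying BSD₂.
* §2 `not_levelTwoScriptLExact_without_selmerFour_of_exists` — granted GZK: if ONE square-free `n ≡ 5, 6, 7 (mod 8)` with `r_an(E_n) = 1`,
  `#Sel₂(E_n) = 2⁵`, `#Sel₄(E_n) ≠ 2⁶` satisfies `BSD(E_n, 2)` and has an integer `L` with `𝓛(n)² = L²`, then the Sel₄-FREE version of C⁺ is FALSE.
  (The residual item 23432 `RamifiedOffJumpOneOfFacts` asserts BSD₂ for such `E_n`; the B-members are their census instances.)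

References: [cite: TianYuanZhang2017, §1 (1.1) (arXiv:1411.4728 p0002 L46–L75)]; [cite: Miller2011LMS, Def. 1.1]; [cite: SilvermanAEC2009, Thm. X.4.2];
[cite: HeathBrown1994SelmerCongruentII, §1]; tree: `P2.CongruentNumberLevelTwoDoor` (§1 `bsdp_two_congruentNumberCurve_iff_of_isScriptL`),
`SecondDescentShaExponentProofs` (`natCard_selmerGroup_four_eq_iff_natCard_primaryComponent_sha_two_eq`), `MonskySelmerParity.natCard_shaTorsionBy_two_eq_pow`,
`card_addPrimaryComponent_eq_pow`.  LEAD memo: `Cruxes/RamifiedOffTYZOfFacts/Lines/offtyz_v7_RigidityAndUnits.md` §3.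
-/

noncomputable section

open scoped Classical

open WeierstrassCurve Summit.BirchSwinnertonDyer.Rank1Residual
  Literature.NumberTheory.EllipticCurves Literature.NumberTheory.EllipticCurves.TianYuanZhang2017

set_option autoImplicit false

namespace Summit.BirchSwinnertonDyer.PrintCf2.LevelTwoDoor

/-! ## §1 The B-side door: granted `BSD(E_n, 2)`, `#Sel₄ ≠ 2⁶` forces `4 ∣ 𝓛(n)` on the `#Sel₂ = 2⁵` rank-one class -/

/-- `Ш[2] ≤ Ш[2^∞]` (an element killed by `2` lies in the `2`-primary component). [folklore] -/
theorem torsionBy_two_le_primaryComponent {G : Type*} [AddCommGroup G] :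
    AddSubgroup.torsionBy G (2 : ℤ) ≤ AddCommGroup.primaryComponent G 2 := by
  intro x hx
  refine (AddCommGroup.mem_primaryComponent).2 ⟨1, ?_⟩
  have hx' : (2 : ℤ) • x = 0 := by simpa using hx
  rw [pow_one, ← natCast_zsmul]
  exact_mod_cast hx'

/-- **`#Ш(E_n)[2] = 4` on the `#Sel₂ = 2⁵` rank-one class** (`2^{rk}·#E_n[2]·#Ш[2] = #Sel₂`, `#E_n(ℚ)[2] = 4`).
[cite: SilvermanAEC2009, Thm. X.4.2] [cite: HeathBrown1994SelmerCongruentII, §1] -/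
theorem natCard_shaTorsionBy_two_eq_four {n : ℕ} [(congruentNumberCurve n).IsElliptic] (hsq : Squarefree n)
    (hrank : (congruentNumberCurve n).mordellWeilRank = 1)
    (hS₂ : Nat.card ((congruentNumberCurve n).selmerGroup 2) = 2 ^ 5) :
    Nat.card (AddSubgroup.torsionBy (congruentNumberCurve n).sha (2 : ℤ)) = 4 := by
  have h' := (MonskySelmerParity.natCard_shaTorsionBy_two_eq_pow hsq.ne_zero (s := 3) hS₂).2
  rw [hrank] at h'
  simpa using h'

/-- **B-SIDE DOOR.**  Granted GZK: for square-free `n` with `ord_{s=1} L(E_n, s) = 1`, `#Sel₂(E_n) = 2⁵`, `#Sel₄(E_n) ≠ 2⁶`, if `BSD(E_n, 2)` holds then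
every integer `L` with `𝓛(n)² = L²` satisfies **`4 ∣ L`**.  Proof: `BSD(E_n,2) ⟺ 2·ord₂ L = ord₂ #Ш(E_n)[2^∞]` (door §1); `#Ш[2] = 4` divides the
`2`-power `#Ш[2^∞]`, which is `≠ 4` (else `#Sel₄ = 2⁶` by the tree's `natCard_selmerGroup_four_eq_iff_natCard_primaryComponent_sha_two_eq`); an even
exponent `≥ 2` and `≠ 2` is `≥ 4`, so `ord₂ L ≥ 2`. [cite: TianYuanZhang2017, §1 (1.1)] [cite: Miller2011LMS, Def. 1.1] [cite: SilvermanAEC2009, Thm. X.4.2] -/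
theorem four_dvd_of_bsdp_two_of_natCard_selmerGroup_four_ne
    (hGZK : rank_eq_analyticRank_of_analyticRank_le_one) {n : ℕ} [(congruentNumberCurve n).IsElliptic]
    (hsq : Squarefree n) (hr : (congruentNumberCurve n).analyticRank = 1) {L : ℤ} (hL : IsScriptL n L)
    (hS₂ : Nat.card ((congruentNumberCurve n).selmerGroup 2) = 2 ^ 5)
    (hS₄ : Nat.card ((congruentNumberCurve n).selmerGroup 4) ≠ 2 ^ 6)
    (hB : BSDp (congruentNumberCurve n) 2) : (4 : ℤ) ∣ L := by
  haveI : Fact (Nat.Prime 2) := ⟨Nat.prime_two⟩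
  obtain ⟨hrank, hfin, hL0, hiff⟩ := P2.bsdp_two_congruentNumberCurve_iff_of_isScriptL hGZK hsq hr hL
  haveI : Finite (congruentNumberCurve n).sha := hfin
  have h2v := hiff.mp hB
  -- `#Ш[2^∞] ≠ 4`
  have hne4 : Nat.card (AddCommGroup.primaryComponent (congruentNumberCurve n).sha 2) ≠ 4 := fun h4 =>
    hS₄ ((natCard_selmerGroup_four_eq_iff_natCard_primaryComponent_sha_two_eq n hsq hrank hS₂).mpr h4)
  -- `#Ш[2^∞] = 2^k` with `4 ∣ 2^k`
  set k := (Nat.card (congruentNumberCurve n).sha).factorization 2 with hk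
  have hpow : Nat.card (AddCommGroup.primaryComponent (congruentNumberCurve n).sha 2) = 2 ^ k :=
    card_addPrimaryComponent_eq_pow (A := (congruentNumberCurve n).sha) 2
  have hdvd : 4 ∣ Nat.card (AddCommGroup.primaryComponent (congruentNumberCurve n).sha 2) := by
    rw [← natCard_shaTorsionBy_two_eq_four hsq hrank hS₂]
    exact AddSubgroup.card_dvd_of_le torsionBy_two_le_primaryComponent
  rw [hpow] at hne4 hdvd h2v
  rw [padicValNat.prime_pow] at h2v
  -- `k ≥ 2`, `k ≠ 2`, `k = 2·ord₂ L` ⟹ `ord₂ L ≥ 2`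
  have hk2 : 2 ≤ k := by
    by_contra hlt
    rw [not_le] at hlt
    interval_cases k <;> norm_num at hdvd
  have hk2' : k ≠ 2 := fun h => hne4 (by rw [h]; norm_num)
  have hv : 2 ≤ padicValInt 2 L := by omega
  have h := (padicValInt_dvd_iff (p := 2) 2 L).mpr (Or.inr hv)
  simpa using h

/-- Granted GZK and `BSD(E_n, 2)`: on the `#Sel₂ = 2⁵` rank-one class `𝓛(n)` is EVEN (`#Ш[2] = 4 ∣ #Ш[2^∞]`, so `2·ord₂ L ≥ 2`).
[cite: TianYuanZhang2017, §1 (1.1)] [cite: Miller2011LMS, Def. 1.1] [cite: SilvermanAEC2009, Thm. X.4.2] -/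
theorem two_dvd_of_bsdp_two_of_natCard_selmerGroup_two
    (hGZK : rank_eq_analyticRank_of_analyticRank_le_one) {n : ℕ} [(congruentNumberCurve n).IsElliptic]
    (hsq : Squarefree n) (hr : (congruentNumberCurve n).analyticRank = 1) {L : ℤ} (hL : IsScriptL n L)
    (hS₂ : Nat.card ((congruentNumberCurve n).selmerGroup 2) = 2 ^ 5)
    (hB : BSDp (congruentNumberCurve n) 2) : (2 : ℤ) ∣ L := by
  haveI : Fact (Nat.Prime 2) := ⟨Nat.prime_two⟩
  obtain ⟨hrank, hfin, hL0, hiff⟩ := P2.bsdp_two_congruentNumberCurve_iff_of_isScriptL hGZK hsq hr hL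
  haveI : Finite (congruentNumberCurve n).sha := hfin
  have h2v := hiff.mp hB
  set k := (Nat.card (congruentNumberCurve n).sha).factorization 2 with hk
  have hpow : Nat.card (AddCommGroup.primaryComponent (congruentNumberCurve n).sha 2) = 2 ^ k :=
    card_addPrimaryComponent_eq_pow (A := (congruentNumberCurve n).sha) 2
  have hdvd : 4 ∣ Nat.card (AddCommGroup.primaryComponent (congruentNumberCurve n).sha 2) := by
    rw [← natCard_shaTorsionBy_two_eq_four hsq hrank hS₂]
    exact AddSubgroup.card_dvd_of_le torsionBy_two_le_primaryComponent
  rw [hpow] at hdvd h2v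
  rw [padicValNat.prime_pow] at h2v
  have hk1 : 1 ≤ k := by
    by_contra hlt
    rw [not_le] at hlt
    interval_cases k; norm_num at hdvd
  have hv : 1 ≤ padicValInt 2 L := by omega
  have h := (padicValInt_dvd_iff (p := 2) 1 L).mpr (Or.inr hv)
  simpa using h

/-- ★ **`2 ∥ 𝓛(n)` DETECTS THE CASSELS–TATE JUMP, granted BSD₂.**  Granted GZK: for square-free `n` with `ord_{s=1} L(E_n, s) = 1`, `#Sel₂(E_n) = 2⁵`,
`BSD(E_n, 2)` and `𝓛(n)² = L²`: **`(2 ∣ L ∧ 4 ∤ L) ⟺ #Sel₄(E_n) = 2⁶`** (⟸ is the level-two door's exactness; ⟹ is the B-side door).  Reading for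
item 23431: its conclusion is FALSE at every member of its Sel₂-class with `#Sel₄ ≠ 2⁶` that satisfies BSD₂ — the hypothesis `#Sel₄(E_n) = 2⁶` is
load-bearing, and no proof of C⁺ can avoid using it. [cite: TianYuanZhang2017, §1 (1.1)] [cite: Miller2011LMS, Def. 1.1] [cite: SilvermanAEC2009, Thm. X.4.2] -/
theorem two_dvd_not_four_dvd_iff_natCard_selmerGroup_four_eq_of_bsdp_two
    (hGZK : rank_eq_analyticRank_of_analyticRank_le_one) {n : ℕ} [(congruentNumberCurve n).IsElliptic]
    (hsq : Squarefree n) (hr : (congruentNumberCurve n).analyticRank = 1) {L : ℤ} (hL : IsScriptL n L)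
    (hS₂ : Nat.card ((congruentNumberCurve n).selmerGroup 2) = 2 ^ 5)
    (hB : BSDp (congruentNumberCurve n) 2) :
    ((2 : ℤ) ∣ L ∧ ¬ (4 : ℤ) ∣ L) ↔ Nat.card ((congruentNumberCurve n).selmerGroup 4) = 2 ^ 6 := by
  constructor
  · rintro ⟨-, h4⟩
    by_contra hS₄
    exact h4 (four_dvd_of_bsdp_two_of_natCard_selmerGroup_four_ne hGZK hsq hr hL hS₂ hS₄ hB)
  · intro hS₄
    exact (P2.bsdp_two_congruentNumberCurve_iff_two_dvd_not_four_dvd hGZK hsq hr hL hS₂ hS₄).mp hB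

/-! ## §2 Consequence for item 23431: the Sel₄-free statement is refuted by any B-member satisfying BSD₂ -/

/-- **The Sel₄-FREE version of C⁺ is false as soon as ONE B-member satisfies BSD₂** (granted GZK): if some square-free `n ≡ 5, 6, 7 (mod 8)` with
`ord_{s=1} L(E_n, s) = 1`, `#Sel₂(E_n) = 2⁵`, `#Sel₄(E_n) ≠ 2⁶` satisfies `BSD(E_n, 2)` and admits an integer `L` with `𝓛(n)² = L²` (TYZ Thm 1.2′), then
«∀ square-free `n ≡ 5,6,7 (8)`, `r_an = 1`, `#Sel₂ = 2⁵` ⟹ `2 ∥ 𝓛(n)`» FAILS (at that `n`: `4 ∣ L`).  The residual item 23432 asserts BSD₂ for exactly such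
`E_n` (off the jump-one isogeny classes), and the LEAD census names instances (9143, 14719, 16639, 18599, 19711; 39263, 41447 with kit j339721).
[cite: TianYuanZhang2017, §1 (1.1) and Thm. 1.2] [cite: Miller2011LMS, Def. 1.1] -/
theorem not_levelTwoScriptLExact_without_selmerFour_of_exists
    (hGZK : rank_eq_analyticRank_of_analyticRank_le_one)
    (hBmember : ∃ (n : ℕ) (_ : (congruentNumberCurve n).IsElliptic), Squarefree n ∧ (n % 8 = 5 ∨ n % 8 = 6 ∨ n % 8 = 7) ∧
      (congruentNumberCurve n).analyticRank = 1 ∧ Nat.card ((congruentNumberCurve n).selmerGroup 2) = 2 ^ 5 ∧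
      Nat.card ((congruentNumberCurve n).selmerGroup 4) ≠ 2 ^ 6 ∧ BSDp (congruentNumberCurve n) 2 ∧ ∃ L : ℤ, IsScriptL n L) :
    ¬ (∀ (n : ℕ) [(congruentNumberCurve n).IsElliptic], Squarefree n → (n % 8 = 5 ∨ n % 8 = 6 ∨ n % 8 = 7) →
        (congruentNumberCurve n).analyticRank = 1 → Nat.card ((congruentNumberCurve n).selmerGroup 2) = 2 ^ 5 →
        ∀ L : ℤ, IsScriptL n L → (2 : ℤ) ∣ L ∧ ¬ (4 : ℤ) ∣ L) := by
  obtain ⟨n, _, hsq, h8, hr, hS₂, hS₄, hB, L, hL⟩ := hBmember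
  intro hC
  exact (hC n hsq h8 hr hS₂ L hL).2 (four_dvd_of_bsdp_two_of_natCard_selmerGroup_four_ne hGZK hsq hr hL hS₂ hS₄ hB)

end Summit.BirchSwinnertonDyer.PrintCf2.LevelTwoDoor

end
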